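import Mathlib
import HarnessLib
import Summits.RiemannHypothesis.RiemannHypothesis.Theorems.IntegerScrewHarmonicK

/-!
# Route `IntegerScrew` — the window integral of THEOREM C's return law: `log T − 1 ≤ ∫₀^T g(τ)dτ ≤ log T + 1`
# (`T ≥ 1`), from `1/τ − 1/τ² ≤ g(τ) ≤ min(1, 1/τ)` (PIVOT-LAW 13.45's «§6.1» input at leading order)

THEOREM N6₁ (PIVOT-LAW 13.45, rh-explicit A6-PIVOT theory) integrates THEOREM C♯'s comparison function
`g(τ) = K(τ,1) = (τ − 1 + 2e^{−τ} − (1+τ)e^{−2τ})/τ²` (`IntegerScrewHarmonicKDefs.ccpg`) over the window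
`τ ≤ L/log L`; at leading order only `∫₀^T g = log T + O(1)` is needed (the exact constant
`∫₀^∞(g − 1/(1+τ)) = γ₀ − log 2` of §6.1 enters THEOREM N6₂, not N6₁).  This file proves the two-sided
elementary version:

* `ccpg_le_one` — `g(τ) ≤ 1` (`τ > 0`; from `g = ∫₀²|1−λ|e^{−τλ}dλ ≤ ∫₀²|1−λ|dλ = 1`);
* `inv_sub_inv_sq_le_ccpg` — `1/τ − 1/τ² ≤ g(τ)` (`τ > 0`; from `1/τ − g = ((1−e^{−τ})² + τe^{−2τ})/τ²` and
  `(1+τ)e^{−τ} ≤ 1`);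
* `intervalIntegrable_ccpg` — `g` is integrable on every `(0, T]`;
* `integral_ccpg_le` — `∫₀^T g ≤ 1 + log T`, and `log_sub_one_le_integral_ccpg` — `log T − 1 ≤ ∫₀^T g` (`T ≥ 1`).

Elementary real analysis; RH-free and walk-free; nothing here bears on the truth of RH.  References: PIVOT-LAW
§13.36, §13.45, CONTINUUM-LIMIT §6.1, §17 (rh-explicit A6-PIVOT); M. Suzuki, J. Lond. Math. Soc. (2) 108 (2023)
1448–1487 [Suzuki2023] for the screw matrices.
-/

noncomputable section

-- D-0017: `Summit.<S>.<S>.…` is the designed namespace of a single-problem summit.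
set_option linter.dupNamespace false

namespace Summit.RiemannHypothesis.RiemannHypothesis.Theorems.IntegerScrew

open Real MeasureTheory intervalIntegral Set

/-- `∫₀² |1 − s| ds = 1`. -/
theorem integral_abs_one_sub_eq_one : ∫ s in (0 : ℝ)..2, |1 - s| = 1 := by
  have hint : ∀ a b : ℝ, IntervalIntegrable (fun s : ℝ => |1 - s|) volume a b :=
    fun a b => ((by fun_prop : Continuous fun s : ℝ => |1 - s|).intervalIntegrable a b)
  rw [← integral_add_adjacent_intervals (hint 0 1) (hint 1 2)]
  have h1 : ∫ s in (0 : ℝ)..1, |1 - s| = ∫ s in (0 : ℝ)..1, (1 - s) := by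
    refine integral_congr fun s hs => ?_
    rw [Set.uIcc_of_le zero_le_one] at hs
    simp only [abs_of_nonneg (sub_nonneg.mpr hs.2)]
  have h2 : ∫ s in (1 : ℝ)..2, |1 - s| = ∫ s in (1 : ℝ)..2, (s - 1) := by
    refine integral_congr fun s hs => ?_
    rw [Set.uIcc_of_le one_le_two] at hs
    simp only [abs_of_nonpos (sub_nonpos.mpr hs.1), neg_sub]
  rw [h1, h2, integral_sub intervalIntegrable_const intervalIntegral.intervalIntegrable_id,
    integral_sub intervalIntegral.intervalIntegrable_id intervalIntegrable_const]
  simp only [intervalIntegral.integral_const, integral_id, smul_eq_mul]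
  norm_num

/-- **`g(τ) ≤ 1`** for `τ > 0`. -/
theorem ccpg_le_one {u : ℝ} (hu : 0 < u) : ccpg u ≤ 1 := by
  rw [ccpg_eq_integral_abs hu.ne']
  refine le_trans ?_ integral_abs_one_sub_eq_one.le
  have hint1 : IntervalIntegrable (fun s : ℝ => |1 - s| * exp (-(u * s))) volume 0 2 :=
    (by fun_prop : Continuous fun s : ℝ => |1 - s| * exp (-(u * s))).intervalIntegrable 0 2
  have hint2 : IntervalIntegrable (fun s : ℝ => |1 - s|) volume 0 2 :=
    (by fun_prop : Continuous fun s : ℝ => |1 - s|).intervalIntegrable 0 2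
  refine integral_mono_on (by norm_num) hint1 hint2 fun s hs => ?_
  have hexp : exp (-(u * s)) ≤ 1 := by
    rw [exp_le_one_iff]
    nlinarith [hs.1, hu.le]
  exact mul_le_of_le_one_right (abs_nonneg _) hexp

/-- **`1/τ − 1/τ² ≤ g(τ)`** for `τ > 0`. -/
theorem inv_sub_inv_sq_le_ccpg {u : ℝ} (hu : 0 < u) : 1 / u - 1 / u ^ 2 ≤ ccpg u := by
  have h := inv_sub_ccpg_eq hu.ne'
  -- (1 − a)² + u a² ≤ 1 with a = e^{−u}, since (1+u)a ≤ 1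
  set a : ℝ := exp (-u) with ha
  have ha0 : 0 < a := exp_pos _
  have ha1 : (1 + u) * a ≤ 1 := by
    rw [ha, Real.exp_neg, ← div_eq_mul_inv, div_le_one (exp_pos u)]
    linarith [Real.add_one_le_exp u]
  have hnum : (1 - a) ^ 2 + u * a ^ 2 ≤ 1 := by
    nlinarith [mul_nonneg ha0.le (sub_nonneg.2 ha1)]
  have hu2 : 0 < u ^ 2 := by positivity
  have hdiv : ((1 - a) ^ 2 + u * a ^ 2) / u ^ 2 ≤ 1 / u ^ 2 :=
    div_le_div_of_nonneg_right hnum hu2.le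
  linarith

/-- `g ≥ 0` at every real argument (junk value `0` at `u = 0` included) for `u ≥ 0`. -/
theorem ccpg_nonneg_of_nonneg {u : ℝ} (hu : 0 ≤ u) : 0 ≤ ccpg u := by
  rcases hu.eq_or_lt with h | h
  · rw [← h]; simp [ccpg]
  · exact (ccpg_pos h).le

/-- `g ≤ 1` for `u ≥ 0` (junk value at `0` included). -/
theorem ccpg_le_one_of_nonneg {u : ℝ} (hu : 0 ≤ u) : ccpg u ≤ 1 := by
  rcases hu.eq_or_lt with h | h
  · rw [← h]; simp [ccpg]
  · exact ccpg_le_one h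

/-- `g` is continuous on `(0, ∞)`. -/
theorem continuousOn_ccpg : ContinuousOn ccpg (Ioi 0) := by
  have e : ccpg = fun u => (u - 1 + 2 * exp (-u) - (1 + u) * exp (-(2 * u))) / u ^ 2 := by
    funext u; rfl
  rw [e]
  exact ContinuousOn.div (by fun_prop) (by fun_prop) fun u hu => pow_ne_zero 2 (ne_of_gt hu)

/-- `g` is (Borel) measurable on `ℝ`. -/
theorem measurable_ccpg : Measurable ccpg := by
  have e : ccpg = fun u => (u - 1 + 2 * exp (-u) - (1 + u) * exp (-(2 * u))) / u ^ 2 := by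
    funext u; rfl
  rw [e]
  exact ((by fun_prop : Continuous fun u : ℝ => u - 1 + 2 * exp (-u) - (1 + u) * exp (-(2 * u))).measurable).div
    ((by fun_prop : Continuous fun u : ℝ => u ^ 2).measurable)

/-- `g` is integrable on `(0, T]`. -/
theorem intervalIntegrable_ccpg {T : ℝ} (hT : 0 ≤ T) : IntervalIntegrable ccpg volume 0 T := by
  rw [intervalIntegrable_iff_integrableOn_Ioc_of_le hT]
  have hmeas : Measurable ccpg := measurable_ccpg
  refine Measure.integrableOn_of_bounded (M := 1) measure_Ioc_lt_top.ne hmeas.aestronglyMeasurable ?_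
  refine (ae_restrict_iff' measurableSet_Ioc).2 (Filter.Eventually.of_forall fun u hu => ?_)
  rw [Real.norm_of_nonneg (ccpg_pos hu.1).le]
  exact ccpg_le_one hu.1

/-- `g` is integrable on `[a, b]` for `0 < a ≤ b`. -/
theorem intervalIntegrable_ccpg_of_pos {a b : ℝ} (ha : 0 < a) (hab : a ≤ b) :
    IntervalIntegrable ccpg volume a b := by
  refine (continuousOn_ccpg.mono fun x hx => ?_).intervalIntegrable
  rw [uIcc_of_le hab] at hx
  exact lt_of_lt_of_le ha hx.1

/-- **Upper window bound**: `∫₀^T g(τ)dτ ≤ 1 + log T` for `T ≥ 1`. -/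
theorem integral_ccpg_le {T : ℝ} (hT : 1 ≤ T) : ∫ τ in (0 : ℝ)..T, ccpg τ ≤ 1 + Real.log T := by
  have hi01 : IntervalIntegrable ccpg volume 0 1 := intervalIntegrable_ccpg zero_le_one
  have hi1T : IntervalIntegrable ccpg volume 1 T := intervalIntegrable_ccpg_of_pos one_pos hT
  rw [← integral_add_adjacent_intervals hi01 hi1T]
  have h1 : ∫ τ in (0 : ℝ)..1, ccpg τ ≤ 1 := by
    have h := integral_mono_on zero_le_one hi01 (intervalIntegrable_const (c := (1 : ℝ)))
      fun u hu => ccpg_le_one_of_nonneg hu.1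
    simpa using h
  have h2 : ∫ τ in (1 : ℝ)..T, ccpg τ ≤ Real.log T := by
    have hinv : IntervalIntegrable (fun τ : ℝ => 1 / τ) volume 1 T := by
      refine (continuousOn_const.div continuousOn_id fun x hx => ?_).intervalIntegrable
      rw [uIcc_of_le hT] at hx
      exact ne_of_gt (lt_of_lt_of_le one_pos hx.1)
    have h := integral_mono_on hT hi1T hinv fun u hu => ccpg_le_inv (lt_of_lt_of_le one_pos hu.1)
    have h0 : (0 : ℝ) ∉ uIcc 1 T := by
      rw [uIcc_of_le hT]; intro h; exact absurd h.1 (by norm_num)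
    rw [integral_one_div h0, div_one] at h
    exact h
  linarith

/-- **Lower window bound**: `log T − 1 ≤ ∫₀^T g(τ)dτ` for `T ≥ 1`. -/
theorem log_sub_one_le_integral_ccpg {T : ℝ} (hT : 1 ≤ T) :
    Real.log T - 1 ≤ ∫ τ in (0 : ℝ)..T, ccpg τ := by
  have hi01 : IntervalIntegrable ccpg volume 0 1 := intervalIntegrable_ccpg zero_le_one
  have hi1T : IntervalIntegrable ccpg volume 1 T := intervalIntegrable_ccpg_of_pos one_pos hT
  rw [← integral_add_adjacent_intervals hi01 hi1T]
  have h1 : 0 ≤ ∫ τ in (0 : ℝ)..1, ccpg τ :=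
    integral_nonneg zero_le_one fun u hu => ccpg_nonneg_of_nonneg hu.1
  have hT0 : 0 < T := lt_of_lt_of_le one_pos hT
  -- ∫₁^T (1/τ − 1/τ²) = log T − (1 − 1/T)
  have hmem : ∀ x ∈ uIcc 1 T, 0 < x := fun x hx => by
    rw [uIcc_of_le hT] at hx; exact lt_of_lt_of_le one_pos hx.1
  have hinv : IntervalIntegrable (fun τ : ℝ => 1 / τ) volume 1 T :=
    (continuousOn_const.div continuousOn_id fun x hx => (hmem x hx).ne').intervalIntegrable
  have hinv2 : IntervalIntegrable (fun τ : ℝ => 1 / τ ^ 2) volume 1 T :=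
    (continuousOn_const.div (continuousOn_id.pow 2) fun x hx => pow_ne_zero 2 (hmem x hx).ne').intervalIntegrable
  have hI1 : ∫ τ in (1 : ℝ)..T, 1 / τ = Real.log T := by
    have h0 : (0 : ℝ) ∉ uIcc 1 T := fun h => absurd (hmem 0 h) (lt_irrefl 0)
    rw [integral_one_div h0, div_one]
  have hI2 : ∫ τ in (1 : ℝ)..T, 1 / τ ^ 2 = 1 - 1 / T := by
    have hderiv : ∀ x ∈ uIcc 1 T, HasDerivAt (fun y : ℝ => 1 - y⁻¹) (1 / x ^ 2) x := by
      intro x hx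
      have h := (hasDerivAt_inv (hmem x hx).ne').const_sub 1
      rw [neg_neg, ← one_div] at h
      exact h
    rw [integral_eq_sub_of_hasDerivAt hderiv hinv2]
    simp only [inv_one, sub_self, sub_zero, one_div]
  have h2 : Real.log T - (1 - 1 / T) ≤ ∫ τ in (1 : ℝ)..T, ccpg τ := by
    have h := integral_mono_on hT (hinv.sub hinv2) hi1T fun u hu => inv_sub_inv_sq_le_ccpg (hmem u (by
      rw [uIcc_of_le hT]; exact hu))
    rwa [integral_sub hinv hinv2, hI1, hI2] at h
  have hT1 : 0 ≤ 1 / T := by positivity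
  linarith

end Summit.RiemannHypothesis.RiemannHypothesis.Theorems.IntegerScrew

end
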